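import Summits.CriticalPhenomena.PercolationContinuityZ3.Theorems.Transplant.FKConnectivityAllQPat3KNetOps
import Summits.CriticalPhenomena.PercolationContinuityZ3.Theorems.Transplant.FKConnectivityAllQPat3SlotLaw
import Summits.CriticalPhenomena.PercolationContinuityZ3.Theorems.Transplant.FKConnectivityAllQPat3BridgeLeafK
import Summits.CriticalPhenomena.PercolationContinuityZ3.Theorems.Transplant.FKConnectivityAllQPat3MinorInduction
import Summits.CriticalPhenomena.PercolationContinuityZ3.Theorems.Transplant.FKConnectivityAllQPat3SPConjecture
import Summits.CriticalPhenomena.PercolationContinuityZ3.Theorems.Transplant.FKConnectivityAllQSPReroot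
import HarnessLib

/-!
# Connectivity correlation inequalities for `φ_{w,q}`, every `q > 0` — THEOREM 𝒯₂(𝒦), THE BRIDGE CASE, part 1
# (census g39 §3 / census g41: helpers and the one-sided two-sum reduction of a mark-free slot)

Proof file (`--supports stmt-CriticalPhenomena-4575`), census lineage (gen 41) of LANE 2's FK sub-programme; builds on p205010 (kernel
theorem, internal audit signed; external expert review pending).  No definitions, no named facts, no sorries; standard axioms.

The BRIDGE case of the induction proving THEOREM 𝒯₂(𝒦) (`…Pat3KNetT2`: every member of `FK.famP11` is nonnegative on every minor
`(E, C)` of every 𝒦-network read at `(pole, pole, inner vertex)`), given the statement for all 𝒦-networks with fewer edges (the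
hypothesis `ih` below).  `N = BRIDGE(Qac, Qad, Qbc, Qbd, Qcd; a, b)` (`FK.IsKNet.bridge`), inner mark `s`:
* `FK.mval2C_eq_two_mul_erase`, `FK.mval2C_nonneg_of_sdiff` — plain slots lying in `E ∩ C` may be removed from `E`;
* `FK.BridgeSep.card_eq` (the five slots are disjoint), `FK.injective_vec4 / _vec5` (names);
* **`FK.bridge_oneSided`** — a mark-free slot `Q` glued to the rest `R` along `u ≠ v`: census g40's one-sided two-sum law
  `FK.lev2C_union_free_nonneg`, its three host variants (slot deleted / free virtual edge / contracted virtual edge) being minors of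
  `R ∪ {uv}` — a 𝒦-network with FEWER edges when `|Q| ≥ 2` (`FK.IsKNet.bridge_shrink_*`) ⇒ `ih`; and its generic form
  `FK.oneSided_of_shrunk` (any table, any three marks off the slot's interior) for THEOREM SP(𝒦);
The three leaf placements (`s` inner to `ac`, inner to `cd`, `s = c`) are `…Pat3KNetCaseAC / CaseCD / CaseC`; the induction itself and
the symmetric placements are `…Pat3KNetT2`.
[cite: AyyerLinussonRavichandran2025, §7 (p. 22)] [cite: Grimmett2006, §3.9 (pp. 63–64)]
-/

namespace Summit.CriticalPhenomena.PercolationContinuityZ3.Theorems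

namespace FK

open SimpleGraph Literature.Probability.LatticeModels Literature.Probability.Percolation
open scoped Classical

variable {V : Type*}

/-! ### Helpers -/

section Helpers

variable [Fintype V]

omit [Fintype V] in
/-- An edge of `E ∩ C` contributes twice: `mval2C w E C = 2 · mval2C w (E ∖ e) C` (both members of the pair carry `e` anyway). [folklore] -/
theorem mval2C_eq_two_mul_erase (w : ℕ → ℝ) {E C : Finset (Sym2 V)} {e : Sym2 V} (heE : e ∈ E) (heC : e ∈ C) (x y s : V)
    (F : ℕ → Pat3 → Pat3 → ℤ) : mval2C w E C x y s F = 2 * mval2C w (E.erase e) C x y s F := by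
  have hnot : e ∉ E.erase e := Finset.notMem_erase e E
  have key : ∀ A : Finset (Sym2 V), e ∉ A →
      mval2C w (insert e A) C x y s F = 2 * mval2C w A C x y s F := by
    intro A hA
    unfold mval2C
    rw [Finset.sum_powerset_insert hA, two_mul]
    congr 1
    · refine Finset.sum_congr rfl fun γ hγ => ?_
      have heγ : e ∉ γ := fun h => hA (Finset.mem_powerset.1 hγ h)
      have h1 : insert e A \ γ ∪ C = A \ γ ∪ C := by
        rw [Finset.insert_sdiff_of_notMem _ heγ, Finset.insert_union, Finset.insert_eq_of_mem (Finset.mem_union_right _ heC)]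
      simp only [apExpC, h1]
    · refine Finset.sum_congr rfl fun γ _ => ?_
      have h1 : insert e γ ∪ C = γ ∪ C := by
        rw [Finset.insert_union, Finset.insert_eq_of_mem (Finset.mem_union_right _ heC)]
      have h2 : insert e A \ insert e γ ∪ C = A \ γ ∪ C := by
        rw [Finset.insert_sdiff_insert, Finset.sdiff_insert_of_notMem hA]
      simp only [apExpC, h1, h2]
  conv_lhs => rw [← Finset.insert_erase heE]
  exact key _ hnot

omit [Fintype V] in
/-- **Doubling away plain slots of `E ∩ C`**: nonnegativity on `(E ∖ D, C)` for `D ⊆ C` gives nonnegativity on `(E, C)`. [folklore] -/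
theorem mval2C_nonneg_of_sdiff (w : ℕ → ℝ) {C D : Finset (Sym2 V)} (hD : D ⊆ C) (x y s : V) (F : ℕ → Pat3 → Pat3 → ℤ) :
    ∀ {E : Finset (Sym2 V)}, 0 ≤ mval2C w (E \ D) C x y s F → 0 ≤ mval2C w E C x y s F := by
  induction D using Finset.induction_on with
  | empty => intro E h; simpa using h
  | @insert e D heD ihD =>
    intro E h
    have hDC : D ⊆ C := fun f hf => hD (Finset.mem_insert_of_mem hf)
    have heC : e ∈ C := hD (Finset.mem_insert_self e D)
    by_cases heE : e ∈ E
    · rw [mval2C_eq_two_mul_erase w heE heC x y s F]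
      refine mul_nonneg (by norm_num) (ihD hDC ?_)
      rwa [Finset.erase_sdiff_comm, ← Finset.sdiff_insert]
    · refine ihD hDC ?_
      rwa [Finset.sdiff_insert_of_notMem heE] at h

omit [Fintype V] in
/-- The five slots of a bridge are pairwise disjoint: the edge count adds up. [folklore] -/
theorem BridgeSep.card_eq {Qac Qad Qbc Qbd Qcd : Finset (Sym2 V)} {a b c d : V} (hsep : BridgeSep Qac Qad Qbc Qbd Qcd a b c d) :
    (Qac ∪ Qad ∪ Qbc ∪ Qbd ∪ Qcd).card = Qac.card + Qad.card + Qbc.card + Qbd.card + Qcd.card := by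
  rw [Finset.card_union_of_disjoint (Finset.disjoint_union_left.2 ⟨Finset.disjoint_union_left.2
      ⟨Finset.disjoint_union_left.2 ⟨hsep.d_ac_cd, hsep.d_ad_cd⟩, hsep.d_bc_cd⟩, hsep.d_bd_cd⟩),
    Finset.card_union_of_disjoint (Finset.disjoint_union_left.2 ⟨Finset.disjoint_union_left.2 ⟨hsep.d_ac_bd, hsep.d_ad_bd⟩,
      hsep.d_bc_bd⟩),
    Finset.card_union_of_disjoint (Finset.disjoint_union_left.2 ⟨hsep.d_ac_bc, hsep.d_ad_bc⟩),
    Finset.card_union_of_disjoint hsep.d_ac_ad]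

omit [Fintype V] in
/-- Four pairwise distinct vertices are injective names `Fin 4 → V`. [folklore] -/
theorem injective_vec4 {a b c d : V} (hab : a ≠ b) (hac : a ≠ c) (had : a ≠ d) (hbc : b ≠ c) (hbd : b ≠ d) (hcd : c ≠ d) :
    Function.Injective ![a, b, c, d] := by
  intro i j h
  fin_cases i <;> fin_cases j <;> simp at h <;>
    first | rfl | exact absurd h ‹_› | exact absurd h.symm ‹_›

omit [Fintype V] in
/-- Five pairwise distinct vertices are injective names `Fin 5 → V`. [folklore] -/
theorem injective_vec5 {a b c d s : V} (hab : a ≠ b) (hac : a ≠ c) (had : a ≠ d) (hbc : b ≠ c) (hbd : b ≠ d) (hcd : c ≠ d)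
    (hsa : s ≠ a) (hsb : s ≠ b) (hsc : s ≠ c) (hsd : s ≠ d) : Function.Injective ![a, b, c, d, s] := by
  intro i j h
  fin_cases i <;> fin_cases j <;> simp at h <;>
    first | rfl | exact absurd h ‹_› | exact absurd h.symm ‹_›

omit [Fintype V] in
/-- Membership in the edge set of a filtered list of named edges. [folklore] -/
theorem mem_plainSet_filter {ι : Type*} (p : ι → V) (S : List (ι × ι)) (f : ι × ι → Bool) (e : Sym2 V) :
    e ∈ plainSet p (S.filter f) ↔ ∃ e₀ ∈ S, f e₀ = true ∧ pedge p e₀ = e := by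
  unfold plainSet
  rw [List.mem_toFinset, List.mem_map]
  constructor
  · rintro ⟨e₀, h, rfl⟩
    rw [List.mem_filter] at h
    exact ⟨e₀, h.1, h.2, rfl⟩
  · rintro ⟨e₀, h, hf, rfl⟩
    exact ⟨e₀, List.mem_filter.2 ⟨h, hf⟩, rfl⟩

omit [Fintype V] in
/-- Membership in the edge set of a list of named edges. [folklore] -/
theorem mem_plainSet_iff {ι : Type*} (p : ι → V) (S : List (ι × ι)) (e : Sym2 V) :
    e ∈ plainSet p S ↔ ∃ e₀ ∈ S, pedge p e₀ = e := by
  unfold plainSet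
  rw [List.mem_toFinset, List.mem_map]

end Helpers

/-! ### The one-sided two-sum reduction of a mark-free slot -/

section OneSided

variable [Fintype V] {n : ℕ}

/-- **ONE-SIDED REDUCTION OF A MARK-FREE SLOT.** `Q` a 𝒦-network between `u ≠ v` glued to the rest `R` along `{u, v}` (disjoint
edges, `uv ∉ R`), the marks `a, b` (poles) and `s` (inner, on `R`) off the interior of `Q`, and `R ∪ {uv}` a 𝒦-network between
`a, b` with at most `n` edges on which the induction hypothesis holds: then every `famP11` member is levelwise nonnegative at
`(a, b, s)` on every minor `(E, C)` of `R ∪ Q` — by `FK.lev2C_union_free_nonneg`, whose three host variants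
`(E ∩ R, C ∩ R)`, `(E ∩ R + uv, C ∩ R)`, `(E ∩ R, C ∩ R + uv)` are minors of `R ∪ {uv}`. [cite: AyyerLinussonRavichandran2025, §7 (p. 22)] -/
theorem bridge_oneSided
    (ih : ∀ ⦃N : Finset (Sym2 V)⦄ ⦃x y : V⦄, N.card ≤ n → IsKNet N x y → ∀ E C : Finset (Sym2 V), E ⊆ N → C ⊆ N →
      ∀ s : V, (∃ e ∈ N, s ∈ e) → s ≠ x → s ≠ y → ∀ w : ℕ → ℝ, (∀ k, 0 ≤ w k) → ∀ i : ℕ, 0 ≤ mval2C w E C x y s (famGet famP11 i))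
    {R Q : Finset (Sym2 V)} {a b u v s : V} (hdRQ : Disjoint R Q)
    (hRQ : ∀ z : V, (∃ e ∈ R, z ∈ e) → (∃ e ∈ Q, z ∈ e) → z = u ∨ z = v) (hQ : IsKNet Q u v) (heR : s(u, v) ∉ R)
    (hN' : IsKNet (R ∪ {s(u, v)}) a b) (hcard : R.card + 1 ≤ n)
    (ha : (∃ e ∈ Q, a ∈ e) → a = u ∨ a = v) (hb : (∃ e ∈ Q, b ∈ e) → b = u ∨ b = v)
    (hsQ : (∃ e ∈ Q, s ∈ e) → s = u ∨ s = v) (hsR : ∃ e ∈ R, s ∈ e) (hsa : s ≠ a) (hsb : s ≠ b)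
    {E C : Finset (Sym2 V)} (hE : E ⊆ R ∪ Q) (hC : C ⊆ R ∪ Q) (i μ : ℕ) :
    0 ≤ lev2C E C a b s (famGet famP11 i) μ := by
  rw [subset_union_split hE, subset_union_split hC]
  have hER : E ∩ R ⊆ R := Finset.inter_subset_right
  have hCR : C ∩ R ⊆ R := Finset.inter_subset_right
  have hEQ : E ∩ Q ⊆ Q := Finset.inter_subset_right
  have hCQ : C ∩ Q ⊆ Q := Finset.inter_subset_right
  have h₁ : ∀ e ∈ (↑(E ∩ R ∪ C ∩ R) : Set (Sym2 V)), ∀ z ∈ e, z ∈ {z : V | ∃ e ∈ R, z ∈ e} :=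
    span_sub_of_subset (fun e he z hz => ⟨e, Finset.mem_coe.1 he, hz⟩) hER hCR
  have h₂ : ∀ e ∈ (↑(E ∩ Q ∪ C ∩ Q) : Set (Sym2 V)), ∀ z ∈ e, z ∈ {z : V | ∃ e ∈ Q, z ∈ e} :=
    span_sub_of_subset (fun e he z hz => ⟨e, Finset.mem_coe.1 he, hz⟩) hEQ hCQ
  have hS : {z : V | ∃ e ∈ R, z ∈ e} ∩ {z : V | ∃ e ∈ Q, z ∈ e} ⊆ ({u, v} : Set V) := fun z hz => by
    rcases hRQ z hz.1 hz.2 with h | h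
    · exact Or.inl h
    · exact Or.inr h
  have hN'card : (R ∪ {s(u, v)}).card ≤ n := (Finset.card_union_le _ _).trans (by simpa using hcard)
  have hsN' : ∃ e ∈ R ∪ {s(u, v)}, s ∈ e := by
    obtain ⟨e, he, hse⟩ := hsR
    exact ⟨e, Finset.mem_union_left _ he, hse⟩
  have sub1 : E ∩ R ⊆ R ∪ {s(u, v)} := hER.trans Finset.subset_union_left
  have sub2 : C ∩ R ⊆ R ∪ {s(u, v)} := hCR.trans Finset.subset_union_left
  have sub3 : insert s(u, v) (E ∩ R) ⊆ R ∪ {s(u, v)} :=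
    Finset.insert_subset (Finset.mem_union_right _ (Finset.mem_singleton_self _)) sub1
  have sub4 : insert s(u, v) (C ∩ R) ⊆ R ∪ {s(u, v)} :=
    Finset.insert_subset (Finset.mem_union_right _ (Finset.mem_singleton_self _)) sub2
  refine lev2C_union_free_nonneg (Finset.disjoint_of_subset_left hER (Finset.disjoint_of_subset_right hEQ hdRQ)) h₁ h₂ hS hQ.ne
    (fun h => heR (hER h)) ha hb hsQ (famGet famP11 i) ?_ ?_ ?_ μ
  · exact lev2C_nonneg_of_mval2C fun w hw => ih hN'card hN' _ _ sub1 sub2 s hsN' hsa hsb w hw i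
  · exact lev2C_nonneg_of_mval2C fun w hw => ih hN'card hN' _ _ sub3 sub2 s hsN' hsa hsb w hw i
  · exact lev2C_nonneg_of_mval2C fun w hw => ih hN'card hN' _ _ sub1 sub4 s hsN' hsa hsb w hw i

/-- **ONE-SIDED REDUCTION, GENERIC FORM (any table, any three marks off the slot's interior)** — the form THEOREM SP(𝒦) needs:
`Q` glued to the rest `R` along `u ≠ v` (disjoint edges, spans meeting inside `{u, v}`, `uv ∉ R`), the marks `x, y, z` each either off
the span of `Q` or in `{u, v}`, and `F` levelwise nonnegative at `(x, y, z)` on EVERY minor of `R ∪ {uv}` (in THEOREM SP(𝒦): the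
induction hypothesis on the bridge with `Q` shrunk to its virtual edge, `FK.IsKNet.bridge_shrink_*`); then `F` is levelwise nonnegative
at `(x, y, z)` on every minor `(E, C)` of `R ∪ Q` (`FK.lev2C_union_free_nonneg`). [cite: AyyerLinussonRavichandran2025, §7 (p. 22)] -/
theorem oneSided_of_shrunk {R Q : Finset (Sym2 V)} {u v x y z : V} (hdRQ : Disjoint R Q)
    (hRQ : ∀ w : V, (∃ e ∈ R, w ∈ e) → (∃ e ∈ Q, w ∈ e) → w = u ∨ w = v) (huv : u ≠ v) (heR : s(u, v) ∉ R)
    (hx : (∃ e ∈ Q, x ∈ e) → x = u ∨ x = v) (hy : (∃ e ∈ Q, y ∈ e) → y = u ∨ y = v) (hz : (∃ e ∈ Q, z ∈ e) → z = u ∨ z = v)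
    (F : ℕ → Pat3 → Pat3 → ℤ)
    (ih : ∀ E' C' : Finset (Sym2 V), E' ⊆ R ∪ {s(u, v)} → C' ⊆ R ∪ {s(u, v)} → ∀ ν : ℕ, 0 ≤ lev2C E' C' x y z F ν)
    {E C : Finset (Sym2 V)} (hE : E ⊆ R ∪ Q) (hC : C ⊆ R ∪ Q) (μ : ℕ) : 0 ≤ lev2C E C x y z F μ := by
  rw [subset_union_split hE, subset_union_split hC]
  have hER : E ∩ R ⊆ R := Finset.inter_subset_right
  have hCR : C ∩ R ⊆ R := Finset.inter_subset_right
  have hEQ : E ∩ Q ⊆ Q := Finset.inter_subset_right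
  have hCQ : C ∩ Q ⊆ Q := Finset.inter_subset_right
  have h₁ : ∀ e ∈ (↑(E ∩ R ∪ C ∩ R) : Set (Sym2 V)), ∀ w ∈ e, w ∈ {w : V | ∃ e ∈ R, w ∈ e} :=
    span_sub_of_subset (fun e he w hw => ⟨e, Finset.mem_coe.1 he, hw⟩) hER hCR
  have h₂ : ∀ e ∈ (↑(E ∩ Q ∪ C ∩ Q) : Set (Sym2 V)), ∀ w ∈ e, w ∈ {w : V | ∃ e ∈ Q, w ∈ e} :=
    span_sub_of_subset (fun e he w hw => ⟨e, Finset.mem_coe.1 he, hw⟩) hEQ hCQ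
  have hS : {w : V | ∃ e ∈ R, w ∈ e} ∩ {w : V | ∃ e ∈ Q, w ∈ e} ⊆ ({u, v} : Set V) := fun w hw => by
    rcases hRQ w hw.1 hw.2 with h | h
    · exact Or.inl h
    · exact Or.inr h
  have sub1 : E ∩ R ⊆ R ∪ {s(u, v)} := hER.trans Finset.subset_union_left
  have sub2 : C ∩ R ⊆ R ∪ {s(u, v)} := hCR.trans Finset.subset_union_left
  have sub3 : insert s(u, v) (E ∩ R) ⊆ R ∪ {s(u, v)} :=
    Finset.insert_subset (Finset.mem_union_right _ (Finset.mem_singleton_self _)) sub1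
  have sub4 : insert s(u, v) (C ∩ R) ⊆ R ∪ {s(u, v)} :=
    Finset.insert_subset (Finset.mem_union_right _ (Finset.mem_singleton_self _)) sub2
  exact lev2C_union_free_nonneg (Finset.disjoint_of_subset_left hER (Finset.disjoint_of_subset_right hEQ hdRQ)) h₁ h₂ hS huv
    (fun h => heR (hER h)) hx hy hz F (ih _ _ sub1 sub2) (ih _ _ sub3 sub2) (ih _ _ sub1 sub4) μ

end OneSided

end FK

end Summit.CriticalPhenomena.PercolationContinuityZ3.Theorems
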